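import Summits.NavierStokesRegularity.NavierStokesRegularity.Theses.LevelSetModeration

/-!
# Vasseur's nonlinear iteration lemma (route `LevelSetModeration`, item `IterationLemma`)

If `0 ≤ W (k+1) ≤ C^(k+1) * (W k)^β` with `C > 1`, `β > 1` and the explicit smallness
`W 0 ≤ C^(-β/(β-1)²)`, then `W k → 0`.  This is Lemma 4 of [Vasseur2007] with the threshold
made explicit.

Proof: by induction `W k ≤ C^(-(α k + γ))` with `α = 1/(β-1)`, `γ = β/(β-1)²` (the exponent
identity `(k+1) - β (α k + γ) = -(α (k+1) + γ)` is an algebraic identity), and the right-hand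
side tends to `0` because `C > 1` and `α > 0`.
-/

-- single-conjunct summit: `Summit.<Summit>.<Problem>` repeats the name by the D-0017 layout
set_option linter.dupNamespace false

namespace Summit.NavierStokesRegularity.NavierStokesRegularity.Theorems

open Filter Topology

/-- The geometric-type majorant `C ^ (-(α k + γ))`, `α = 1/(β-1)`, `γ = β/(β-1)²`, dominates any
nonnegative sequence with `W (k+1) ≤ C^(k+1) (W k)^β` and `W 0 ≤ C^(-γ)` (Vasseur's induction). -/
theorem iterationLemma_majorant {C β : ℝ} (hC : 1 < C) (hβ : 1 < β) (W : ℕ → ℝ)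
    (hW0 : ∀ k, 0 ≤ W k) (hrec : ∀ k, W (k + 1) ≤ C ^ (k + 1) * (W k) ^ β)
    (hinit : W 0 ≤ C ^ (-(β / (β - 1) ^ 2))) (k : ℕ) :
    W k ≤ C ^ (-(1 / (β - 1) * k + β / (β - 1) ^ 2)) := by
  have hβ1 : (β - 1) ≠ 0 := (sub_pos.mpr hβ).ne'
  have hC0 : 0 < C := lt_trans zero_lt_one hC
  induction k with
  | zero => simpa using hinit
  | succ k ih =>
    calc W (k + 1) ≤ C ^ (k + 1) * (W k) ^ β := hrec k
      _ ≤ C ^ (k + 1) * (C ^ (-(1 / (β - 1) * k + β / (β - 1) ^ 2))) ^ β := by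
          exact mul_le_mul_of_nonneg_left
            (Real.rpow_le_rpow (hW0 k) ih (le_trans zero_le_one hβ.le)) (by positivity)
      _ = C ^ (((k : ℝ) + 1) + (-(1 / (β - 1) * k + β / (β - 1) ^ 2)) * β) := by
          rw [← Real.rpow_mul hC0.le, Real.rpow_add hC0, ← Real.rpow_natCast]
          push_cast
          ring_nf
      _ = C ^ (-(1 / (β - 1) * ((k + 1 : ℕ) : ℝ) + β / (β - 1) ^ 2)) := by
          congr 1
          push_cast
          field_simp
          ring

/-- **Vasseur's nonlinear iteration lemma** with explicit threshold ([Vasseur2007], Lemma 4):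
`0 ≤ W (k+1) ≤ C^(k+1) (W k)^β`, `C > 1`, `β > 1`, `W 0 ≤ C^(-β/(β-1)²)` imply `W k → 0`.
Closes route item `IterationLemma` of `LevelSetModeration`. -/
theorem iterationLemma_proof :
    Summit.NavierStokesRegularity.NavierStokesRegularity.Theses.LevelSetModeration.IterationLemma := by
  unfold Theses.LevelSetModeration.IterationLemma
  intro C β hC hβ W hW0 hrec hinit
  have hα : 0 < 1 / (β - 1) := by
    have : 0 < β - 1 := sub_pos.mpr hβ
    positivity
  -- the exponent tends to `-∞`
  have hexp : Tendsto (fun k : ℕ => -(1 / (β - 1) * (k : ℝ) + β / (β - 1) ^ 2)) atTop atBot := by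
    apply tendsto_neg_atTop_atBot.comp
    apply tendsto_atTop_add_const_right
    exact (tendsto_natCast_atTop_atTop).const_mul_atTop hα
  -- hence the majorant tends to `0`
  have hmaj : Tendsto (fun k : ℕ => C ^ (-(1 / (β - 1) * (k : ℝ) + β / (β - 1) ^ 2)))
      atTop (𝓝 0) :=
    (tendsto_rpow_atBot_of_base_gt_one C hC).comp hexp
  exact squeeze_zero (fun k => hW0 k)
    (fun k => iterationLemma_majorant hC hβ W hW0 hrec hinit k) hmaj

end Summit.NavierStokesRegularity.NavierStokesRegularity.Theorems
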